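import Literature.Analysis.FunctionSpaces.TorusClassicalNSPerturbedRestart
import Literature.Analysis.FluidPDE.TorusClassicalNSH4Level
import Literature.Analysis.FluidPDE.TorusClassicalNSEnstrophyLifespan
import HarnessLib

/-!
# Continuation of classical Navier–Stokes solutions on `T³` near a background trajectory of the forced
# system, with a life span controlled by the enstrophy

Analysis/FluidPDE proof file (theorems only; no definitions, no named facts): the EXISTENCE HALF of the
local theory of strong solutions on `T³` in the classical (smooth-data) vocabulary
`Torus.IsClassicalNSSolutionOn` (Robinson–Rodrigo–Sadowski 2016, Thm 6.8: from `u₀ ∈ V` a strong solution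
exists on `[0, T]`, `T = T(‖∇u₀‖₂)`; Thm 7.5: it is smooth for `t > 0`; Constantin–Foias 1988, Ch. 10), for
the FORCED system NS_ν(F) with a force that drives a given classical background solution `(ū, p̄)` on
`[0, L]` (the force is absorbed by the background: `u = ū + v` with `v` solving the perturbation system of
`TorusPerturbedNSLocalExistence`). Main theorem
`Torus.IsClassicalNSSolutionOn.exists_forced_solution_of_gradNormSq_le`: on `T^d`, `card d = 3`, for
`ν > 0`, a background `(ū, p̄)` with mean-zero slices on `[0, L]`, `L > 0`, and an enstrophy level `E₁`
there is `T ∈ (0, L]` such that EVERY smooth divergence-free mean-zero datum `u₀` with `‖∇u₀‖₂² ≤ E₁`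
launches a classical solution `(u, p)` of NS_ν(F) on `[0, T] × T^d` with `u(0) = u₀`, mean-zero slices
and `‖∇u(t)‖₂² ≤ 2E₁ + 1` — the life span depends on the datum through the enstrophy only.

THE ARGUMENT (`T = min (L/2) T₂`, `T₂` the `V`-lifespan of `TorusClassicalNSEnstrophyLifespan`):
(0) from `u₀` the capped perturbed local existence theorem (`Torus.perturbedNS_exists_local_of_le`, level
= the fourth Sobolev sums of `u₀ − ū(0)`) gives `v` on `[0, θ₀]` and `u = ū + v` solves NS_ν(F)
(`Torus.IsClassicalNSSolutionOn.add_perturbation`) on `[0, b₀]`, `b₀ = min θ₀ T`; (1) with the lapse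
`τ = b₀/4` FIXED, every classical solution through `u₀` on `[0, b]`, `b ≤ T`, has enstrophy `≤ 2E₁ + 1`
(`enstrophy_lifespan`), hence `∫ ‖Δ²u(s)‖² ≤ C₄` for `s ≥ 3τ`
(`integral_norm_laplacian_laplacian_sq_le_of_gradNormSq_le`, the `H² → H³ → H⁴` smoothing chain), hence
restart data `u(s) − ū(s)` of fourth Sobolev sums `≤ M = 2C₄ + 2D` (`D` the `H⁴` bound of `ū` on the
compact `[0, L]`); (2) the capped perturbed local existence theorem at level `M` gives a step `θ ≤ L/2`
INDEPENDENT of `b`, and `Torus.classicalNS_continuation_step` restarts at `s₀ = max 3τ (b − θ/2)`,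
identifies on `[s₀, b]` and glues (`Torus.IsClassicalNSSolutionOn.glue_restart`), reaching `b + θ/2`;
(3) `⌈(T − b₀)/(θ/2)⌉` steps reach `T` (`Torus.classicalNS_continuation_extend`, template
`IsFracNSReynoldsOn.extend_forward`); the enstrophy bound on `[0, T]` is `enstrophy_lifespan` once more.
Deliberately NOT here: uniqueness/continuous dependence in `V` (Thm 6.10, `TorusClassicalNSUniqueness` /
`TorusClassicalNSVStability`), `V`-valued (non-smooth) data, the blow-up alternative.

## Mathlib / tree search

Tree (reused): `Torus.IsClassicalNSSolutionOn.enstrophy_lifespan` (`TorusClassicalNSEnstrophyLifespan`),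
`Torus.perturbedNS_exists_local_of_le`, `….add_perturbation`, `….glue_restart`
(`TorusClassicalNSPerturbedRestart`), `….integral_norm_laplacian_laplacian_sq_le_of_gradNormSq_le`,
`Torus.sum_one_add_freqNormSq_pow_four_mul_sq_norm_mFourierCoeff_sub_le`,
`Torus.IsSmoothSpaceTimeOn.exists_integral_norm_laplacian_laplacian_sq_le` (`TorusClassicalNSH4Level`),
`Torus.divergence_sub`, `Torus.HasZeroMean.add/sub`, `Torus.IsClassicalNSSolutionOn.mono`; Mathlib
`exists_nat_ge`. Searched `exists_forced_solution|continuation_step|exists_classicalNS`: only the UNFORCED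
smooth-data local existence `Torus.exists_classicalNS_smooth(_of_sobolevBound)` (`TorusNSSmoothLocalExistence`,
life span from the `H⁴` level) and the Euler / fractional continuation templates.

## References

* J. C. Robinson, J. L. Rodrigo, W. Sadowski, *The Three-Dimensional Navier–Stokes Equations*, CUP 2016,
  Thm 6.8, Thm 7.5, §8.1. [RobinsonRodrigoSadowskiCUP2016]
* P. Constantin, C. Foias, *Navier–Stokes Equations*, Univ. Chicago Press 1988, Ch. 10. [ConstantinFoiasNSE1988]
* A. J. Majda, A. L. Bertozzi, *Vorticity and Incompressible Flow*, CUP 2002, §3.2.3 (continuation by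
  restarting and uniqueness). [MajdaBertozziCUP2002]
-/

noncomputable section

open MeasureTheory Set Function Filter UnitAddTorus
open scoped ContDiff InnerProductSpace RealInnerProductSpace Topology NNReal

namespace Literature.Analysis.FluidPDE

open Literature.Analysis.FunctionSpaces

variable {d : Type*} [Fintype d] [DecidableEq d]

/-! ### One restart step and its iteration -/

section Continuation

variable {ν L T θ σ M : ℝ} {F : UnitAddTorus d → EuclideanSpace ℝ d}
  {ū : ℝ → UnitAddTorus d → EuclideanSpace ℝ d} {pbar : ℝ → UnitAddTorus d → ℝ}
  {u₀ : UnitAddTorus d → EuclideanSpace ℝ d}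

/-- **One continuation step near a background trajectory.** Let `(ū, p̄)` solve NS_ν(F), `ν ≥ 0`, on
`[0, L] × T^d` with mean-zero slices; suppose (restart) that from every `t₀ ∈ [0, L − θ]` and every smooth
divergence-free mean-zero `v₀` with fourth Sobolev sums `≤ M` the perturbation system around `ū` has a
smooth solution on `[t₀, t₀ + θ]` with `v(t₀) = v₀` (`Torus.perturbedNS_exists_local_of_le`), `θ > 0`,
`T + θ ≤ L`, and (a priori bound) that every classical solution `(u, p)` of NS_ν(F) on `[0, b]`,
`σ < b ≤ T`, with `u(0) = u₀` and mean-zero slices has restart data `u(s) − ū(s)` of fourth Sobolev sums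
`≤ M` at all `s ∈ [σ, b]`, `σ ≥ 0`. Then a classical solution on `[0, b]`, `σ < b < T`, through `u₀` with
mean-zero slices extends to `[0, b + θ/2]` (same datum, mean-zero slices): restart at
`s₀ = max σ (b − θ/2)` from `v₀ = u(s₀) − ū(s₀)`, add the background (`add_perturbation`), identify on
`[s₀, b]` and glue (`glue_restart`) — Robinson–Rodrigo–Sadowski 2016, §8.1. [folklore] -/
theorem Torus.classicalNS_continuation_step (hν : 0 ≤ ν)
    (hū : Torus.IsClassicalNSSolutionOn (Icc 0 L) ν (fun _ => F) ū pbar)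
    (hūmean : ∀ t ∈ Icc 0 L, Torus.HasZeroMean (ū t)) (hθ : 0 < θ) (hTL : T + θ ≤ L) (hσ : 0 ≤ σ)
    (hrestart : ∀ t₀ ∈ Icc 0 L, t₀ + θ ≤ L →
      ∀ (v₀ : UnitAddTorus d → EuclideanSpace ℝ d), Torus.IsSmooth v₀ → Torus.IsDivFree v₀ →
      Torus.HasZeroMean v₀ →
      (∀ S : Finset (d → ℤ),
        ∑ k ∈ S, (1 + Torus.freqNormSq k) ^ 4 * ‖mFourierCoeff (EuclideanSpace.complexify ∘ v₀) k‖ ^ 2 ≤ M) →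
      ∃ (v : ℝ → UnitAddTorus d → EuclideanSpace ℝ d) (q : ℝ → UnitAddTorus d → ℝ),
        Torus.IsSmoothSpaceTimeOn (Icc t₀ (t₀ + θ)) v ∧ Torus.IsSmoothSpaceTimeOn (Icc t₀ (t₀ + θ)) q ∧
        (∀ t ∈ Icc t₀ (t₀ + θ), Torus.IsDivFree (v t)) ∧ (∀ t ∈ Icc t₀ (t₀ + θ), Torus.HasZeroMean (v t)) ∧
        (∀ t ∈ Icc t₀ (t₀ + θ), Torus.HasZeroMean (q t)) ∧
        (∀ t ∈ Icc t₀ (t₀ + θ), ∀ x, Torus.timeDerivWithin (Icc t₀ (t₀ + θ)) v t x +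
          Torus.convect (v t) (v t) x + Torus.convect (ū t) (v t) x + Torus.convect (v t) (ū t) x =
            ν • Torus.laplacian (v t) x - Torus.gradient (q t) x) ∧
        v t₀ = v₀)
    (hbound : ∀ (b : ℝ) (u : ℝ → UnitAddTorus d → EuclideanSpace ℝ d) (p : ℝ → UnitAddTorus d → ℝ),
      σ < b → b ≤ T → Torus.IsClassicalNSSolutionOn (Icc 0 b) ν (fun _ => F) u p → u 0 = u₀ →
      (∀ t ∈ Icc 0 b, Torus.HasZeroMean (u t)) →
      ∀ s ∈ Icc σ b, ∀ S : Finset (d → ℤ),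
        ∑ k ∈ S, (1 + Torus.freqNormSq k) ^ 4 *
          ‖mFourierCoeff (EuclideanSpace.complexify ∘ fun y => u s y - ū s y) k‖ ^ 2 ≤ M)
    {b : ℝ} (hσb : σ < b) (hbT : b < T) {u : ℝ → UnitAddTorus d → EuclideanSpace ℝ d}
    {p : ℝ → UnitAddTorus d → ℝ} (hu : Torus.IsClassicalNSSolutionOn (Icc 0 b) ν (fun _ => F) u p)
    (hu0 : u 0 = u₀) (humean : ∀ t ∈ Icc 0 b, Torus.HasZeroMean (u t)) :
    ∃ (u' : ℝ → UnitAddTorus d → EuclideanSpace ℝ d) (p' : ℝ → UnitAddTorus d → ℝ),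
      Torus.IsClassicalNSSolutionOn (Icc 0 (b + θ / 2)) ν (fun _ => F) u' p' ∧ u' 0 = u₀ ∧
        ∀ t ∈ Icc 0 (b + θ / 2), Torus.HasZeroMean (u' t) := by
  -- the restart time `s₀ = max σ (b - θ/2)`
  set s₀ : ℝ := max σ (b - θ / 2)
  have hs₀σ : σ ≤ s₀ := le_max_left _ _
  have hs₀0 : 0 ≤ s₀ := hσ.trans hs₀σ
  have hs₀b : s₀ < b := max_lt hσb (by linarith)
  have hbs₀ : b + θ / 2 ≤ s₀ + θ := by
    have : b - θ / 2 ≤ s₀ := le_max_right _ _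
    linarith
  have hs₀θL : s₀ + θ ≤ L := by linarith
  have hs₀L : s₀ ∈ Icc 0 L := ⟨hs₀0, by linarith⟩
  have hs₀mem : s₀ ∈ Icc 0 b := ⟨hs₀0, hs₀b.le⟩
  -- the restart datum `v₀ = u(s₀) - ū(s₀)`
  have hus : Torus.IsSmooth (u s₀) := hu.smooth_velocity.isSmooth_slice hs₀mem
  have hūs : Torus.IsSmooth (ū s₀) := hū.smooth_velocity.isSmooth_slice hs₀L
  have hv₀ : Torus.IsSmooth (fun y => u s₀ y - ū s₀ y) := hus.sub hūs
  have hv₀div : Torus.IsDivFree (fun y => u s₀ y - ū s₀ y) := fun x => by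
    rw [show (fun y => u s₀ y - ū s₀ y) = u s₀ - ū s₀ from rfl,
      Torus.divergence_sub (hus.isContDiff (by simp)) (hūs.isContDiff (by simp)), hu.divFree s₀ hs₀mem x,
      hū.divFree s₀ hs₀L x, sub_zero]
  have hv₀mean : Torus.HasZeroMean (fun y => u s₀ y - ū s₀ y) :=
    (humean s₀ hs₀mem).sub (hūmean s₀ hs₀L) hus.integrable hūs.integrable
  have hMv₀ := hbound b u p hσb hbT.le hu hu0 humean s₀ ⟨hs₀σ, hs₀b.le⟩
  obtain ⟨v, q, hv, hq, hvdiv, hvmean, -, hveq, hvs₀⟩ :=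
    hrestart s₀ hs₀L hs₀θL _ hv₀ hv₀div hv₀mean hMv₀
  -- the restarted solution of NS_ν(F) on `[s₀, s₀ + θ]`
  have hs₀θ : s₀ < s₀ + θ := by linarith
  have hūw : Torus.IsClassicalNSSolutionOn (Icc s₀ (s₀ + θ)) ν (fun _ => F) ū pbar :=
    hū.mono (Icc_subset_Icc hs₀0 hs₀θL) (uniqueDiffOn_Icc hs₀θ)
  have h₂ := hūw.add_perturbation hs₀θ hv hq hvdiv hveq
  have h0 : (fun t x => ū t x + v t x) s₀ = u s₀ := by
    funext x
    show ū s₀ x + v s₀ x = u s₀ x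
    rw [hvs₀]
    show ū s₀ x + (u s₀ x - ū s₀ x) = u s₀ x
    abel
  -- identify on `[s₀, b]` and glue
  obtain ⟨u', p', hsol, hleft, hcases⟩ := hu.glue_restart hν h₂ hs₀0 hs₀b (by linarith) h0
  have hpos : 0 < b + θ / 2 := by linarith [hσ.trans_lt hσb]
  refine ⟨u', p', hsol.mono (Icc_subset_Icc le_rfl hbs₀) (uniqueDiffOn_Icc hpos),
    (hleft 0 ⟨le_rfl, hs₀0⟩).trans hu0, fun t ht => ?_⟩
  rcases hcases t ⟨ht.1, ht.2.trans hbs₀⟩ with ⟨ht₁, hte⟩ | ⟨ht₂, hte⟩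
  · rw [hte]
    exact humean t ht₁
  · rw [hte]
    have hūt : Torus.IsSmooth (ū t) := hū.smooth_velocity.isSmooth_slice ⟨hs₀0.trans ht₂.1, ht₂.2.trans hs₀θL⟩
    exact (hūmean t ⟨hs₀0.trans ht₂.1, ht₂.2.trans hs₀θL⟩).add (hvmean t ht₂) hūt.integrable
      (hv.isSmooth_slice ht₂).integrable

/-- **Iteration of the continuation step.** Under the hypotheses of `Torus.classicalNS_continuation_step`,
a classical solution of NS_ν(F) on `[0, b₀]`, `σ < b₀ ≤ T`, through `u₀` with mean-zero slices extends to
`[0, min (b₀ + n θ/2) T]` for every `n`, keeping the datum and the mean-zero slices (induction on `n`;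
template `IsFracNSReynoldsOn.extend_forward`). [folklore] -/
theorem Torus.classicalNS_continuation_extend (hν : 0 ≤ ν)
    (hū : Torus.IsClassicalNSSolutionOn (Icc 0 L) ν (fun _ => F) ū pbar)
    (hūmean : ∀ t ∈ Icc 0 L, Torus.HasZeroMean (ū t)) (hθ : 0 < θ) (hTL : T + θ ≤ L) (hσ : 0 ≤ σ)
    (hrestart : ∀ t₀ ∈ Icc 0 L, t₀ + θ ≤ L →
      ∀ (v₀ : UnitAddTorus d → EuclideanSpace ℝ d), Torus.IsSmooth v₀ → Torus.IsDivFree v₀ →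
      Torus.HasZeroMean v₀ →
      (∀ S : Finset (d → ℤ),
        ∑ k ∈ S, (1 + Torus.freqNormSq k) ^ 4 * ‖mFourierCoeff (EuclideanSpace.complexify ∘ v₀) k‖ ^ 2 ≤ M) →
      ∃ (v : ℝ → UnitAddTorus d → EuclideanSpace ℝ d) (q : ℝ → UnitAddTorus d → ℝ),
        Torus.IsSmoothSpaceTimeOn (Icc t₀ (t₀ + θ)) v ∧ Torus.IsSmoothSpaceTimeOn (Icc t₀ (t₀ + θ)) q ∧
        (∀ t ∈ Icc t₀ (t₀ + θ), Torus.IsDivFree (v t)) ∧ (∀ t ∈ Icc t₀ (t₀ + θ), Torus.HasZeroMean (v t)) ∧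
        (∀ t ∈ Icc t₀ (t₀ + θ), Torus.HasZeroMean (q t)) ∧
        (∀ t ∈ Icc t₀ (t₀ + θ), ∀ x, Torus.timeDerivWithin (Icc t₀ (t₀ + θ)) v t x +
          Torus.convect (v t) (v t) x + Torus.convect (ū t) (v t) x + Torus.convect (v t) (ū t) x =
            ν • Torus.laplacian (v t) x - Torus.gradient (q t) x) ∧
        v t₀ = v₀)
    (hbound : ∀ (b : ℝ) (u : ℝ → UnitAddTorus d → EuclideanSpace ℝ d) (p : ℝ → UnitAddTorus d → ℝ),
      σ < b → b ≤ T → Torus.IsClassicalNSSolutionOn (Icc 0 b) ν (fun _ => F) u p → u 0 = u₀ →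
      (∀ t ∈ Icc 0 b, Torus.HasZeroMean (u t)) →
      ∀ s ∈ Icc σ b, ∀ S : Finset (d → ℤ),
        ∑ k ∈ S, (1 + Torus.freqNormSq k) ^ 4 *
          ‖mFourierCoeff (EuclideanSpace.complexify ∘ fun y => u s y - ū s y) k‖ ^ 2 ≤ M)
    {b₀ : ℝ} (hσb₀ : σ < b₀) (hb₀T : b₀ ≤ T) {u : ℝ → UnitAddTorus d → EuclideanSpace ℝ d}
    {p : ℝ → UnitAddTorus d → ℝ} (hu : Torus.IsClassicalNSSolutionOn (Icc 0 b₀) ν (fun _ => F) u p)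
    (hu0 : u 0 = u₀) (humean : ∀ t ∈ Icc 0 b₀, Torus.HasZeroMean (u t)) (n : ℕ) :
    ∃ (u' : ℝ → UnitAddTorus d → EuclideanSpace ℝ d) (p' : ℝ → UnitAddTorus d → ℝ),
      Torus.IsClassicalNSSolutionOn (Icc 0 (min (b₀ + n * (θ / 2)) T)) ν (fun _ => F) u' p' ∧ u' 0 = u₀ ∧
        ∀ t ∈ Icc 0 (min (b₀ + n * (θ / 2)) T), Torus.HasZeroMean (u' t) := by
  induction n with
  | zero =>
    refine ⟨u, p, ?_, hu0, ?_⟩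
    · simp only [Nat.cast_zero, zero_mul, add_zero, min_eq_left hb₀T]
      exact hu
    · simp only [Nat.cast_zero, zero_mul, add_zero, min_eq_left hb₀T]
      exact humean
  | succ n ih =>
    obtain ⟨v, q, hv, hv0, hvm⟩ := ih
    set b : ℝ := min (b₀ + n * (θ / 2)) T with hb_def
    by_cases hbT : b₀ + n * (θ / 2) < T
    · have hb_eq : b = b₀ + n * (θ / 2) := min_eq_left hbT.le
      have hσb : σ < b := by
        rw [hb_eq]
        exact hσb₀.trans_le (le_add_of_nonneg_right (by positivity))
      have hbT' : b < T := by rw [hb_eq]; exact hbT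
      obtain ⟨u', p', hu', hu'0, hm'⟩ :=
        Torus.classicalNS_continuation_step hν hū hūmean hθ hTL hσ hrestart hbound hσb hbT' hv hv0 hvm
      have hsub : Icc 0 (min (b₀ + (↑(n + 1) : ℝ) * (θ / 2)) T) ⊆ Icc 0 (b + θ / 2) := by
        refine Icc_subset_Icc le_rfl ((min_le_left _ _).trans (le_of_eq ?_))
        rw [hb_eq]; push_cast; ring
      have hpos : 0 < min (b₀ + (↑(n + 1) : ℝ) * (θ / 2)) T :=
        lt_min ((hσ.trans_lt hσb₀).trans_le (le_add_of_nonneg_right (by positivity)))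
          ((hσ.trans_lt hσb₀).trans_le hb₀T)
      exact ⟨u', p', hu'.mono hsub (uniqueDiffOn_Icc hpos), hu'0, fun t ht => hm' t (hsub ht)⟩
    · -- already at `T`
      have hb_eq : b = T := min_eq_right (not_lt.1 hbT)
      have hset : min (b₀ + (↑(n + 1) : ℝ) * (θ / 2)) T = T := by
        refine min_eq_right ((not_lt.1 hbT).trans ?_)
        push_cast
        nlinarith
      refine ⟨v, q, ?_, hv0, ?_⟩
      · rw [hset, ← hb_eq]; exact hv
      · rw [hset, ← hb_eq]; exact hvm

end Continuation

/-! ### The main theorem -/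

/-- **Classical solutions of the forced Navier–Stokes system on `T³` from smooth data near a background
trajectory, with a life span controlled by the enstrophy** (Robinson–Rodrigo–Sadowski 2016, Thm 6.8 with
Thm 7.5: local strong solutions with `T = T(‖∇u₀‖₂)`, smooth for `t > 0`; here for NS_ν(F) with the force
absorbed by a background solution). On `T^d` with `card d = 3`, for `ν > 0`, `L > 0`, a classical
solution `(ū, p̄)` of NS_ν(F) on `[0, L] × T^d` with mean-zero velocity slices, and an enstrophy level
`E₁`, there is `T` with `0 < T ≤ L` such that for EVERY smooth divergence-free mean-zero `u₀` with
`‖∇u₀‖₂² ≤ E₁` there is a classical solution `(u, p)` of NS_ν(F) on `[0, T] × T^d` with `u(0) = u₀`,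
mean-zero velocity slices and `‖∇u(t)‖₂² ≤ 2E₁ + 1` on `[0, T]`. Proof: `T = min (L/2) T₂` with `T₂` the
`V`-lifespan of `enstrophy_lifespan`; a first piece from the capped perturbed local existence theorem at
the datum's own `H⁴` level; then restarts with a step `θ(ν, ū, M)` uniform in the restart time, `M` the
`H⁴` level of `u(s) − ū(s)` after the lapse `3τ` supplied by the smoothing chain under the a priori
enstrophy bound `2E₁ + 1` (`Torus.classicalNS_continuation_step/extend`); finally `enstrophy_lifespan` on
`[0, T]`. [cite: RobinsonRodrigoSadowskiCUP2016, Thm 6.8 with Thm 7.5] -/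
theorem _root_.Literature.Analysis.FunctionSpaces.Torus.IsClassicalNSSolutionOn.exists_forced_solution_of_gradNormSq_le
    (hd : Fintype.card d = 3) {ν : ℝ} (hν : 0 < ν) {F : UnitAddTorus d → EuclideanSpace ℝ d} {L : ℝ}
    (hL : 0 < L) {ū : ℝ → UnitAddTorus d → EuclideanSpace ℝ d} {pbar : ℝ → UnitAddTorus d → ℝ}
    (hū : Torus.IsClassicalNSSolutionOn (Icc 0 L) ν (fun _ => F) ū pbar)
    (hūmean : ∀ t ∈ Icc 0 L, Torus.HasZeroMean (ū t)) (E₁ : ℝ) :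
    ∃ T : ℝ, 0 < T ∧ T ≤ L ∧ ∀ (u₀ : UnitAddTorus d → EuclideanSpace ℝ d), Torus.IsSmooth u₀ →
      Torus.IsDivFree u₀ → Torus.HasZeroMean u₀ → Torus.gradNormSq u₀ ≤ E₁ →
      ∃ (u : ℝ → UnitAddTorus d → EuclideanSpace ℝ d) (p : ℝ → UnitAddTorus d → ℝ),
        Torus.IsClassicalNSSolutionOn (Icc 0 T) ν (fun _ => F) u p ∧ u 0 = u₀ ∧
        (∀ t ∈ Icc 0 T, Torus.HasZeroMean (u t)) ∧ ∀ t ∈ Icc 0 T, Torus.gradNormSq (u t) ≤ 2 * E₁ + 1 := by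
  -- the force levels and the `V`-lifespan
  set G : ℝ := Torus.gradNormSq F
  set G₂ : ℝ := ∫ x, ‖Torus.laplacian F x‖ ^ 2
  set G₃ : ℝ := Torus.gradNormSq (Torus.laplacian F)
  obtain ⟨T₂, hT₂, Y, hlife⟩ := Torus.IsClassicalNSSolutionOn.enstrophy_lifespan (d := d) hd hν E₁ G
  set T : ℝ := min (L / 2) T₂
  have hT0 : 0 < T := lt_min (half_pos hL) hT₂
  have hTL2 : T ≤ L / 2 := min_le_left _ _
  have hTT₂ : T ≤ T₂ := min_le_right _ _
  refine ⟨T, hT0, by linarith, fun u₀ hu₀ hu₀div hu₀mean hE₁ => ?_⟩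
  -- the a priori enstrophy bound of solutions through `u₀` on `[0, b]`, `b ≤ T`
  have henst : ∀ (b : ℝ) (u : ℝ → UnitAddTorus d → EuclideanSpace ℝ d) (p : ℝ → UnitAddTorus d → ℝ),
      0 < b → b ≤ T → Torus.IsClassicalNSSolutionOn (Icc 0 b) ν (fun _ => F) u p → u 0 = u₀ →
      ∀ t ∈ Icc 0 b, Torus.gradNormSq (u t) ≤ 2 * E₁ + 1 := by
    intro b u p hb hbT h h0 t ht
    have h0' : Torus.gradNormSq (u 0) ≤ E₁ := by rw [h0]; exact hE₁
    exact (hlife h hb h0' (fun s _ => le_rfl)).1 t ht (by linarith [ht.2])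
  -- the `H⁴` bound of the background on `[0, L]`
  obtain ⟨D, hD⟩ := hū.smooth_velocity.exists_integral_norm_laplacian_laplacian_sq_le hL
  have h0L : (0 : ℝ) ∈ Icc 0 L := ⟨le_rfl, hL.le⟩
  -- Phase 1: a first piece at the datum's own `H⁴` level
  have hū0 : Torus.IsSmooth (ū 0) := hū.smooth_velocity.isSmooth_slice h0L
  have hv₀ : Torus.IsSmooth (fun y => u₀ y - ū 0 y) := hu₀.sub hū0
  have hv₀div : Torus.IsDivFree (fun y => u₀ y - ū 0 y) := fun x => by
    rw [show (fun y => u₀ y - ū 0 y) = u₀ - ū 0 from rfl,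
      Torus.divergence_sub (hu₀.isContDiff (by simp)) (hū0.isContDiff (by simp)), hu₀div x,
      hū.divFree 0 h0L x, sub_zero]
  have hv₀mean : Torus.HasZeroMean (fun y => u₀ y - ū 0 y) :=
    hu₀mean.sub (hūmean 0 h0L) hu₀.integrable hū0.integrable
  have hM₀ := Torus.sum_one_add_freqNormSq_pow_four_mul_sq_norm_mFourierCoeff_le hv₀ hv₀mean
  obtain ⟨θ₀, hθ₀, hθ₀L2, hE5₀⟩ := Torus.perturbedNS_exists_local_of_le hd.le hν hL hū.smooth_velocity
    hū.divFree (∫ x, ‖Torus.laplacian (Torus.laplacian fun y => u₀ y - ū 0 y) x‖ ^ 2) (half_pos hL)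
  obtain ⟨v, q, hv, hq, hvdiv, hvmean, -, hveq, hv0⟩ :=
    hE5₀ 0 h0L (by linarith) _ hv₀ hv₀div hv₀mean hM₀
  rw [zero_add] at hv hq hvdiv hvmean hveq
  have hθ₀L : θ₀ ≤ L := by linarith
  have h₁ : Torus.IsClassicalNSSolutionOn (Icc 0 θ₀) ν (fun _ => F) (fun t x => ū t x + v t x)
      (fun t x => pbar t x + q t x) :=
    (hū.mono (Icc_subset_Icc le_rfl hθ₀L) (uniqueDiffOn_Icc hθ₀)).add_perturbation hθ₀ hv hq hvdiv hveq
  set b₀ : ℝ := min θ₀ T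
  have hb₀0 : 0 < b₀ := lt_min hθ₀ hT0
  have hb₀T : b₀ ≤ T := min_le_right _ _
  have hb₀θ : b₀ ≤ θ₀ := min_le_left _ _
  have h₁' : Torus.IsClassicalNSSolutionOn (Icc 0 b₀) ν (fun _ => F) (fun t x => ū t x + v t x)
      (fun t x => pbar t x + q t x) :=
    h₁.mono (Icc_subset_Icc le_rfl hb₀θ) (uniqueDiffOn_Icc hb₀0)
  have hdat : (fun t x => ū t x + v t x) 0 = u₀ := by
    funext x
    show ū 0 x + v 0 x = u₀ x
    rw [hv0]
    show ū 0 x + (u₀ x - ū 0 x) = u₀ x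
    abel
  have hmean₁ : ∀ t ∈ Icc 0 b₀, Torus.HasZeroMean ((fun t x => ū t x + v t x) t) := fun t ht =>
    (hūmean t ⟨ht.1, ht.2.trans (hb₀θ.trans hθ₀L)⟩).add (hvmean t ⟨ht.1, ht.2.trans hb₀θ⟩)
      (hū.smooth_velocity.isSmooth_slice ⟨ht.1, ht.2.trans (hb₀θ.trans hθ₀L)⟩).integrable
      (hv.isSmooth_slice ⟨ht.1, ht.2.trans hb₀θ⟩).integrable
  -- Phase 2: the uniform restart level after the lapse `3τ`, `τ = b₀/4`, and the uniform step `θ`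
  set τ : ℝ := b₀ / 4 with hτ
  have hτ0 : 0 < τ := by positivity
  obtain ⟨C₄, hC₄⟩ :=
    Torus.IsClassicalNSSolutionOn.integral_norm_laplacian_laplacian_sq_le_of_gradNormSq_le (d := d) hd hν
      (2 * E₁ + 1) G G₂ G₃ hτ0
  obtain ⟨θ, hθ, hθL, hE5⟩ := Torus.perturbedNS_exists_local_of_le hd.le hν hL hū.smooth_velocity hū.divFree
    (2 * C₄ + 2 * D) (half_pos hL)
  have hbound : ∀ (b : ℝ) (u : ℝ → UnitAddTorus d → EuclideanSpace ℝ d) (p : ℝ → UnitAddTorus d → ℝ),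
      3 * τ < b → b ≤ T → Torus.IsClassicalNSSolutionOn (Icc 0 b) ν (fun _ => F) u p → u 0 = u₀ →
      (∀ t ∈ Icc 0 b, Torus.HasZeroMean (u t)) →
      ∀ s ∈ Icc (3 * τ) b, ∀ S : Finset (d → ℤ),
        ∑ k ∈ S, (1 + Torus.freqNormSq k) ^ 4 *
          ‖mFourierCoeff (EuclideanSpace.complexify ∘ fun y => u s y - ū s y) k‖ ^ 2 ≤ 2 * C₄ + 2 * D := by
    intro b u p hb hbT h h0 hm s hs S
    have hb0 : 0 < b := by linarith
    have hsb : s ∈ Icc 0 b := ⟨by linarith [hs.1], hs.2⟩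
    have hsL : s ∈ Icc 0 L := ⟨hsb.1, by linarith [hs.2]⟩
    have h4 := hC₄ h hm (henst b u p hb0 hbT h h0) (fun _ _ => le_rfl) (fun _ _ => le_rfl) (fun _ _ => le_rfl)
      s hsb (by linarith [hs.1])
    exact Torus.sum_one_add_freqNormSq_pow_four_mul_sq_norm_mFourierCoeff_sub_le
      (h.smooth_velocity.isSmooth_slice hsb) (hū.smooth_velocity.isSmooth_slice hsL) (hm s hsb)
      (hūmean s hsL) h4 (hD s hsL) S
  -- Phase 3: finitely many steps reach `T`
  obtain ⟨n, hn⟩ := exists_nat_ge ((T - b₀) / (θ / 2))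
  have hστ : (0 : ℝ) ≤ 3 * τ := by positivity
  have hσb₀ : 3 * τ < b₀ := by rw [hτ]; linarith
  obtain ⟨u, p, hsol, hu0', hmean⟩ := Torus.classicalNS_continuation_extend hν.le hū hūmean hθ
    (by linarith) hστ hE5 hbound hσb₀ hb₀T h₁' hdat hmean₁ n
  have hmin : min (b₀ + n * (θ / 2)) T = T := by
    refine min_eq_right ?_
    have h1 : T - b₀ ≤ n * (θ / 2) := (div_le_iff₀ (half_pos hθ)).1 hn
    linarith
  rw [hmin] at hsol hmean
  exact ⟨u, p, hsol, hu0', hmean, henst T u p hT0 le_rfl hsol hu0'⟩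

end Literature.Analysis.FluidPDE

end
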